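import Literature.MathematicalPhysics.QuantumLattice.SmoothingLocalityProofs
import Literature.MathematicalPhysics.QuantumLattice.StabilityRotatedDecompositionProofs
import Literature.MathematicalPhysics.QuantumLattice.StabilityPowerBoundAdapterProofs
import HarnessLib

/-!
# Uniform power-law tails of the smoothing map along the perturbed path

Top-down layer (seat B) of the formalisation of the Michalakis–Zwolak stability theorem
(hubbard.S19, `Literature.MathematicalPhysics.QuantumLattice.michalakis_zwolak`): MZ13 Lemma 1
(iv) in the exact form consumed by `michalakis_zwolak_of_tail_core` and by the construction of the
spectral-flow generator as a quasi-local interaction. For the Hamiltonians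
`H = Σ_Z Φ Z + c Σ_Z V Z` (`Φ` of range `r₀` with terms of norm `≤ 1`, `V` of range `r` with terms
of norm `≤ 1`, `|c| ≤ 1` real) and any integrable weight `w` with finite moments, for every `p`
there is `C_p ≥ 0` depending only on `w, d, |κ|, q, r₀, r`, the radius `R` of the observable and
`p` — **not on the volume, on `c` or on the interactions** — with
`‖𝓕_w(O) − 𝔼_{b_x(R+ℓ)ᶜ}(𝓕_w(O))‖ ≤ ‖O‖ C_p/(ℓ+1)^p` for all `O ∈ 𝔄_{b_x(R)}` and ALL `ℓ`
(`exists_smoothing_tail_bound`; `𝓕_w(O) = ∫ w(t) τ_t^{H}(O) dt`). Ingredients: seat A's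
`norm_smoothing_sub_twirl_le` / `exists_integral_norm_mul_min_le_div_pow` re-packaged with the
volume quantified inside (`exists_norm_smoothing_sub_twirl_le_div_pow_uniform`), the local norms
and size caps of `Φ + c V` (uniform in the volume by ball counting), and the conversion of the
coarse-grained bounds `C/⌊(ℓ+1)/(R̄+1)⌋^p`, `R̄ = max r₀ r`, into `B/(ℓ+1)^p`
(`le_pow_bound_of_floor_bound`). No definitions, no named facts (theorems only).
-/

noncomputable section

open Matrix Complex MeasureTheory Finset
open scoped Matrix.Norms.L2Operator

namespace Literature.MathematicalPhysics.QuantumLattice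

open Literature.Probability.LatticeModels

/-! ### From coarse-grained to plain power bounds, with explicit constants -/

/-- **Explicit power bound from a coarse-grained bound** (pointwise form of
`exists_pow_bound_of_floor_bound`): if `0 ≤ e ≤ M` and `e ≤ C/⌊(ℓ+1)/k⌋^p` whenever `k ≤ ℓ + 1`
(`k ≥ 1`, `C ≥ 0`), then `e ≤ (C (2k)^p + M k^p)/(ℓ+1)^p`. [folklore] -/
theorem le_pow_bound_of_floor_bound {e M C : ℝ} {k ℓ p : ℕ} (hk : 0 < k) (he : 0 ≤ e)
    (hM : e ≤ M) (hC0 : 0 ≤ C)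
    (hC : k ≤ ℓ + 1 → e ≤ C / ((((ℓ + 1) / k : ℕ) : ℝ)) ^ p) :
    e ≤ (C * (2 * k) ^ p + M * (k : ℝ) ^ p) / ((ℓ : ℝ) + 1) ^ p := by
  have hM0 : 0 ≤ M := he.trans hM
  have hkr : (0 : ℝ) < k := by exact_mod_cast hk
  have hℓ1 : (0 : ℝ) < (ℓ : ℝ) + 1 := by positivity
  rw [le_div_iff₀ (pow_pos hℓ1 p)]
  rcases lt_or_ge (ℓ + 1) k with hlt | hge
  · have h1 : ((ℓ : ℝ) + 1) ^ p ≤ (k : ℝ) ^ p := by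
      refine pow_le_pow_left₀ hℓ1.le ?_ p
      exact_mod_cast hlt.le
    have h2 : e * ((ℓ : ℝ) + 1) ^ p ≤ M * (k : ℝ) ^ p := mul_le_mul hM h1 (by positivity) hM0
    have h3 : 0 ≤ C * (2 * (k : ℝ)) ^ p := by positivity
    linarith
  · set nb : ℕ := (ℓ + 1) / k with hnb
    have hnb1 : 1 ≤ nb := (Nat.le_div_iff_mul_le hk).mpr (by simpa using hge)
    have hnbr : (0 : ℝ) < nb := by exact_mod_cast hnb1
    have hkey : (ℓ : ℝ) + 1 ≤ 2 * (k : ℝ) * nb := by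
      have := succ_le_two_mul_mul_div hk hge
      exact_mod_cast this
    have h1 : e ≤ C / (nb : ℝ) ^ p := hC hge
    have h2 : ((ℓ : ℝ) + 1) ^ p ≤ (2 * (k : ℝ)) ^ p * (nb : ℝ) ^ p := by
      rw [← mul_pow]; exact pow_le_pow_left₀ hℓ1.le hkey p
    calc e * ((ℓ : ℝ) + 1) ^ p ≤ C / (nb : ℝ) ^ p * ((2 * (k : ℝ)) ^ p * (nb : ℝ) ^ p) :=
          mul_le_mul h1 h2 (by positivity) (by positivity)
      _ = C * (2 * (k : ℝ)) ^ p := by field_simp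
      _ ≤ C * (2 * (k : ℝ)) ^ p + M * (k : ℝ) ^ p := by
          have : 0 ≤ M * (k : ℝ) ^ p := by positivity
          linarith

/-! ### MZ13 Lemma 1 (iv), uniformly in the volume -/

section Uniform

variable (d : ℕ) {κ : Type*} [Fintype κ] [DecidableEq κ] (q : ℕ)

/-- **MZ13 Lemma 1 (iv), constants uniform in the volume.** The statement of
`exists_norm_smoothing_sub_twirl_le_div_pow` with the volume `L` quantified INSIDE the
existential: for a weight `w` with finite moments and every `p` there is `B ≥ 0` (depending on
`w`, `p`, `V`, `J`, `N_r`, `r₀`, `r` only) such that on every torus `(ℤ/L)^d × κ`, for every local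
interaction of range `r₀`, local norm `≤ J` and term size `≤ V`, every centre `x` with
`|b_x(r)| ≤ N_r`, every `O ∈ 𝔄_{b_x(r)}` and every `ℓ ≥ r₀`:
`‖𝓕_w(O) − 𝔼_{b_x(r+ℓ)ᶜ}(𝓕_w(O))‖ ≤ ‖O‖ B/⌊(ℓ+1)/(r₀+1)⌋^p`. The proof is seat A's, verbatim
up to the placement of the volume. [cite: MichalakisZwolakCMP2013, §5.1 Lemma 1 (iv) (arXiv:1109.1588 p. 9)] -/
theorem exists_norm_smoothing_sub_twirl_le_div_pow_uniform {w : ℝ → ℂ} (hw : Integrable w)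
    (hmomi : ∀ k : ℕ, Integrable fun t : ℝ => ‖t‖ ^ k * ‖w t‖) {J : ℝ} (hJ0 : 0 ≤ J)
    {V : ℕ} (hV1 : 1 ≤ V) (N_r : ℕ) (r₀ r p : ℕ) :
    ∃ B : ℝ, 0 ≤ B ∧ ∀ {L : ℕ} [NeZero L] {Φ : Interaction (TorusSite d L × κ) q}, Φ.IsLocal →
      (∀ Z, r₀ < torusDiam Z → Φ Z = 0) →
      (∀ y : TorusSite d L × κ, ∑ Z ∈ univ.filter (fun Z : Finset (TorusSite d L × κ) => y ∈ Z),
        ‖Φ Z‖ ≤ J) →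
      (∀ Z, Φ Z ≠ 0 → #Z ≤ V) → ∀ (x : TorusSite d L),
      #(cellBall x r : Finset (TorusSite d L × κ)) ≤ N_r →
      ∀ {O : Op (TorusSite d L × κ) q}, IsSupportedOn O (cellBall x r) → ∀ {ℓ : ℕ}, r₀ ≤ ℓ →
      ‖(∫ t : ℝ, w t • heisenbergEvolution (localHamiltonian Φ univ) t O) -
          twirl (cellBall x (r + ℓ))ᶜ
            (∫ t : ℝ, w t • heisenbergEvolution (localHamiltonian Φ univ) t O)‖ ≤
        ‖O‖ * B / ((((ℓ + 1) / (r₀ + 1) : ℕ) : ℝ)) ^ p := by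
  have hv : 0 < 2 * Real.exp 1 * V * J + 1 := by positivity
  obtain ⟨B, hB0, hB⟩ := exists_integral_norm_mul_min_le_div_pow hw hmomi
    (C := 2 * N_r / V) (by positivity) one_pos hv zero_le_one p
  refine ⟨B, hB0, fun {L} _ Φ hΦ hrange hJ hV x hcard O hO ℓ hℓ => ?_⟩
  set ℓ' : ℕ := (ℓ + 1) / (r₀ + 1) with hℓ'
  have hℓ'1 : 1 ≤ ℓ' := Nat.div_pos (by omega) (Nat.succ_pos r₀)
  have h1 := norm_smoothing_sub_twirl_le hΦ hrange hJ0 hJ hV1 hV x hℓ hO hw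
  refine h1.trans ?_
  have hO0 := norm_nonneg O
  have hVr : (0 : ℝ) < V := by exact_mod_cast hV1
  have hpt : ∀ t : ℝ, ‖w t‖ * min (2 * ‖O‖ * (#(cellBall x r : Finset (TorusSite d L × κ)) / V) *
      Real.exp (-(1 * (ℓ' : ℝ)) + 2 * Real.exp 1 * V * J * |t|)) (2 * ‖O‖) ≤
      ‖O‖ * (‖w t‖ * min (2 * N_r / V * Real.exp (-(1 * (ℓ' : ℝ)) + (2 * Real.exp 1 * V * J + 1) * |t|))
        (2 * 1)) := by
    intro t
    rw [mul_left_comm]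
    refine mul_le_mul_of_nonneg_left ?_ (norm_nonneg _)
    have hcard' : (#(cellBall x r : Finset (TorusSite d L × κ)) : ℝ) ≤ N_r := by exact_mod_cast hcard
    have hexp : Real.exp (-(1 * (ℓ' : ℝ)) + 2 * Real.exp 1 * V * J * |t|) ≤
        Real.exp (-(1 * (ℓ' : ℝ)) + (2 * Real.exp 1 * V * J + 1) * |t|) :=
      Real.exp_le_exp.mpr (by nlinarith [abs_nonneg t])
    have hA : 2 * ‖O‖ * (#(cellBall x r : Finset (TorusSite d L × κ)) / V) *
          Real.exp (-(1 * (ℓ' : ℝ)) + 2 * Real.exp 1 * V * J * |t|) ≤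
        ‖O‖ * (2 * N_r / V * Real.exp (-(1 * (ℓ' : ℝ)) + (2 * Real.exp 1 * V * J + 1) * |t|)) := by
      calc 2 * ‖O‖ * (#(cellBall x r : Finset (TorusSite d L × κ)) / V) *
            Real.exp (-(1 * (ℓ' : ℝ)) + 2 * Real.exp 1 * V * J * |t|)
          ≤ 2 * ‖O‖ * (N_r / V) * Real.exp (-(1 * (ℓ' : ℝ)) + (2 * Real.exp 1 * V * J + 1) * |t|) := by
            gcongr
        _ = ‖O‖ * (2 * N_r / V * Real.exp (-(1 * (ℓ' : ℝ)) + (2 * Real.exp 1 * V * J + 1) * |t|)) := by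
            ring
    rcases le_total (2 * N_r / V * Real.exp (-(1 * (ℓ' : ℝ)) + (2 * Real.exp 1 * V * J + 1) * |t|))
      (2 * 1) with hce | hce
    · rw [min_eq_left hce]
      exact (min_le_left _ _).trans hA
    · rw [min_eq_right hce]
      exact (min_le_right _ _).trans (le_of_eq (by ring))
  have hint : Integrable fun t : ℝ => ‖O‖ * (‖w t‖ *
      min (2 * N_r / V * Real.exp (-(1 * (ℓ' : ℝ)) + (2 * Real.exp 1 * V * J + 1) * |t|)) (2 * 1)) := by
    refine ((hw.norm.mul_const (2 * 1)).const_mul ‖O‖).mono' ?_ (Filter.Eventually.of_forall fun t => ?_)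
    · exact ((hw.aestronglyMeasurable.norm.mul (by fun_prop : Continuous fun t : ℝ =>
        min (2 * N_r / V * Real.exp (-(1 * (ℓ' : ℝ)) + (2 * Real.exp 1 * V * J + 1) * |t|))
          (2 * 1)).aestronglyMeasurable).const_mul ‖O‖)
    · rw [Real.norm_eq_abs, abs_mul, abs_mul, abs_norm, abs_norm]
      refine mul_le_mul_of_nonneg_left (mul_le_mul_of_nonneg_left ?_ (norm_nonneg _)) hO0
      rw [abs_le]; constructor
      · have : 0 ≤ min (2 * N_r / V * Real.exp (-(1 * (ℓ' : ℝ)) + (2 * Real.exp 1 * V * J + 1) * |t|))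
          (2 * 1) := le_min (by positivity) (by norm_num)
        linarith
      · exact min_le_right _ _
  calc ∫ t : ℝ, ‖w t‖ * min (2 * ‖O‖ * (#(cellBall x r : Finset (TorusSite d L × κ)) / V) *
          Real.exp (-(1 * (ℓ' : ℝ)) + 2 * Real.exp 1 * V * J * |t|)) (2 * ‖O‖)
      ≤ ∫ t : ℝ, ‖O‖ * (‖w t‖ *
          min (2 * N_r / V * Real.exp (-(1 * (ℓ' : ℝ)) + (2 * Real.exp 1 * V * J + 1) * |t|)) (2 * 1)) :=
        integral_mono_of_nonneg (Filter.Eventually.of_forall fun t => mul_nonneg (norm_nonneg _)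
          (le_min (by positivity) (by positivity))) hint (Filter.Eventually.of_forall hpt)
    _ = ‖O‖ * ∫ t : ℝ, ‖w t‖ *
          min (2 * N_r / V * Real.exp (-(1 * (ℓ' : ℝ)) + (2 * Real.exp 1 * V * J + 1) * |t|)) (2 * 1) :=
        integral_const_mul _ _
    _ ≤ ‖O‖ * (B / (ℓ' : ℝ) ^ p) := mul_le_mul_of_nonneg_left (hB ℓ' hℓ'1) hO0
    _ = ‖O‖ * B / (ℓ' : ℝ) ^ p := by ring

end Uniform

/-! ### The interactions `Φ + c V`: locality, range, local norms, size caps -/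

section Combo

variable {d L : ℕ} [NeZero L] {κ : Type*} [Fintype κ] [DecidableEq κ] {q : ℕ}

omit [DecidableEq κ] in
/-- A region of diameter `≤ R` containing `y` lies in the ball of radius `R` about `y`.
[folklore] -/
theorem subset_cellBall_of_mem_of_torusDiam_le {Z : Finset (TorusSite d L × κ)}
    {y : TorusSite d L × κ} (hy : y ∈ Z) {R : ℕ} (hR : torusDiam Z ≤ R) : Z ⊆ cellBall y.1 R :=
  fun _ hz => mem_cellBall_iff.2 ((torusDist_le_torusDiam hy hz).trans hR)

/-- **Local norm of a finite-range interaction with bounded terms, uniformly in the volume**: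
if `Φ Z = 0` for `diam Z > R` and `‖Φ Z‖ ≤ 1`, then `Σ_{Z ∋ y} ‖Φ Z‖ ≤ 2^{(2R+1)^d |κ|}` (the
non-zero terms containing `y` are among the subsets of `b_y(R)`). [folklore] -/
theorem sum_norm_filter_mem_le_two_pow {Φ : Interaction (TorusSite d L × κ) q} {R : ℕ}
    (hrange : ∀ Z, R < torusDiam Z → Φ Z = 0) (hnorm : ∀ Z, ‖Φ Z‖ ≤ 1) (y : TorusSite d L × κ) :
    ∑ Z ∈ univ.filter (fun Z : Finset (TorusSite d L × κ) => y ∈ Z), ‖Φ Z‖ ≤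
      (2 : ℝ) ^ ((2 * R + 1) ^ d * Fintype.card κ) := by
  classical
  set S := (univ.filter (fun Z : Finset (TorusSite d L × κ) => y ∈ Z)).filter fun Z => Φ Z ≠ 0
    with hS
  have h1 : ∑ Z ∈ S, ‖Φ Z‖ =
      ∑ Z ∈ univ.filter (fun Z : Finset (TorusSite d L × κ) => y ∈ Z), ‖Φ Z‖ := by
    rw [hS]
    exact Finset.sum_filter_of_ne fun Z _ hZ h0 => hZ (by rw [h0, norm_zero])
  have h2 : ∀ Z ∈ S, Z ⊆ cellBall y.1 R := by
    intro Z hZ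
    simp only [hS, Finset.mem_filter, Finset.mem_univ, true_and] at hZ
    exact subset_cellBall_of_mem_of_torusDiam_le hZ.1 (not_lt.mp fun h => hZ.2 (hrange Z h))
  have h3 := card_filter_subset_le_two_pow y.1 R S h2
  rw [← h1]
  calc ∑ Z ∈ S, ‖Φ Z‖ ≤ ∑ _Z ∈ S, (1 : ℝ) := Finset.sum_le_sum fun Z _ => hnorm Z
    _ = S.card := by simp
    _ ≤ (2 : ℝ) ^ ((2 * R + 1) ^ d * Fintype.card κ) := by exact_mod_cast h3

omit [DecidableEq κ] in
/-- **Size cap of a finite-range interaction, uniformly in the volume**: a non-zero term of an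
interaction of range `R` has at most `(2R+1)^d |κ|` sites. [folklore] -/
theorem card_le_of_torusDiam_le {Z : Finset (TorusSite d L × κ)} {R : ℕ} (hR : torusDiam Z ≤ R) :
    #Z ≤ (2 * R + 1) ^ d * Fintype.card κ := by
  rcases Z.eq_empty_or_nonempty with h | ⟨z, hz⟩
  · rw [h]; simp
  · exact (card_le_card (subset_cellBall_of_mem_of_torusDiam_le hz hR)).trans (card_cellBall_le z.1 R)

/-- The local Hamiltonian is homogeneous in the interaction. [folklore] -/
theorem localHamiltonian_smul {Λ : Type*} {q : ℕ} (c : ℂ) (Φ : Interaction Λ q) (Λ' : Finset Λ) :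
    localHamiltonian (c • Φ) Λ' = c • localHamiltonian Φ Λ' := by
  simp [localHamiltonian, Finset.smul_sum]

/-- **The interaction `Φ + c V` of the perturbed path** (`c` real, `|c| ≤ 1`; `Φ` of range `r₀`,
`V` of range `r`, all terms of norm `≤ 1`): it is local, has range `max r₀ r`, local norm
`≤ 2^{(2r₀+1)^d|κ|} + 2^{(2r+1)^d|κ|}`, non-zero terms of size `≤ (2 max(r₀,r)+1)^d |κ|`, and its
Hamiltonian is `Σ Φ + c Σ V`. [folklore] -/
theorem combo_interaction {Φ V : Interaction (TorusSite d L × κ) q} (hΦ : Φ.IsLocal) {r₀ r : ℕ}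
    (hΦr : ∀ Z, r₀ < torusDiam Z → Φ Z = 0) (hΦn : ∀ Z, ‖Φ Z‖ ≤ 1) (hV : V.IsLocal)
    (hVr : ∀ Z, r < torusDiam Z → V Z = 0) (hVn : ∀ Z, ‖V Z‖ ≤ 1) {c : ℝ} (hc : |c| ≤ 1) :
    (Φ + (c : ℂ) • V).IsLocal ∧
    (∀ Z, max r₀ r < torusDiam Z → (Φ + (c : ℂ) • V) Z = 0) ∧
    (∀ y : TorusSite d L × κ, ∑ Z ∈ univ.filter (fun Z : Finset (TorusSite d L × κ) => y ∈ Z),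
        ‖(Φ + (c : ℂ) • V) Z‖ ≤
      (2 : ℝ) ^ ((2 * r₀ + 1) ^ d * Fintype.card κ) + (2 : ℝ) ^ ((2 * r + 1) ^ d * Fintype.card κ)) ∧
    (∀ Z, (Φ + (c : ℂ) • V) Z ≠ 0 → #Z ≤ (2 * max r₀ r + 1) ^ d * Fintype.card κ) ∧
    localHamiltonian (Φ + (c : ℂ) • V) univ = ∑ Z, Φ Z + (c : ℂ) • ∑ Z, V Z := by
  refine ⟨fun Z => ⟨?_, ?_⟩, fun Z hZ => ?_, fun y => ?_, fun Z hZ => ?_, ?_⟩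
  · simp only [Interaction.add_apply, Interaction.smul_apply]
    exact (hΦ.isSupportedOn Z).add ((hV.isSupportedOn Z).smul _)
  · simp only [Interaction.add_apply, Interaction.smul_apply]
    exact (hΦ.isHermitian Z).add (isHermitian_ofReal_smul (hV.isHermitian Z) c)
  · simp only [Interaction.add_apply, Interaction.smul_apply]
    rw [hΦr Z (lt_of_le_of_lt (le_max_left _ _) hZ), hVr Z (lt_of_le_of_lt (le_max_right _ _) hZ),
      smul_zero, add_zero]
  · have hc1 : ‖(c : ℂ)‖ ≤ 1 := by rw [Complex.norm_real, Real.norm_eq_abs]; exact hc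
    calc ∑ Z ∈ univ.filter (fun Z : Finset (TorusSite d L × κ) => y ∈ Z), ‖(Φ + (c : ℂ) • V) Z‖
        ≤ ∑ Z ∈ univ.filter (fun Z : Finset (TorusSite d L × κ) => y ∈ Z), (‖Φ Z‖ + ‖V Z‖) := by
          refine Finset.sum_le_sum fun Z _ => ?_
          simp only [Interaction.add_apply, Interaction.smul_apply]
          refine (norm_add_le _ _).trans (add_le_add le_rfl ?_)
          rw [norm_smul]
          exact (mul_le_of_le_one_left (norm_nonneg _) hc1)
      _ ≤ _ := by
          rw [Finset.sum_add_distrib]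
          exact add_le_add (sum_norm_filter_mem_le_two_pow hΦr hΦn y)
            (sum_norm_filter_mem_le_two_pow hVr hVn y)
  · refine card_le_of_torusDiam_le (not_lt.mp fun h => hZ ?_)
    simp only [Interaction.add_apply, Interaction.smul_apply]
    rw [hΦr Z (lt_of_le_of_lt (le_max_left _ _) h), hVr Z (lt_of_le_of_lt (le_max_right _ _) h),
      smul_zero, add_zero]
  · rw [localHamiltonian_add, localHamiltonian_smul, localHamiltonian_univ_eq_sum,
      localHamiltonian_univ_eq_sum]

end Combo

/-! ### MZ13 Lemma 1 (iv) along the path: all radii, plain power law, uniform constants -/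

section Main

variable (d : ℕ) (κ : Type*) [Fintype κ] [DecidableEq κ] (q : ℕ)

/-- **Uniform power-law tails of the smoothing map along the perturbed path (MZ13 Lemma 1
(iv)).** For an integrable weight `w` with finite moments and every `r₀ r R p` there is `C ≥ 0`
such that on every torus, for all local `Φ` (range `r₀`, `‖Φ Z‖ ≤ 1`), `V` (range `r`,
`‖V Z‖ ≤ 1`), real `|c| ≤ 1`, every centre `x`, every `O ∈ 𝔄_{b_x(R)}` and EVERY `ℓ`:
`‖𝓕(O) − 𝔼_{b_x(R+ℓ)ᶜ}(𝓕(O))‖ ≤ ‖O‖ C/(ℓ+1)^p`, `𝓕(O) = ∫ w(t) τ_t^{Σ Φ + c Σ V}(O) dt`.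
[cite: MichalakisZwolakCMP2013, §5.1 Lemma 1 (iv) (arXiv:1109.1588 pp. 9–10)] -/
theorem exists_smoothing_tail_bound {w : ℝ → ℂ} (hw : Integrable w)
    (hmomi : ∀ k : ℕ, Integrable fun t : ℝ => ‖t‖ ^ k * ‖w t‖) (r₀ r R p : ℕ) :
    ∃ C : ℝ, 0 ≤ C ∧ ∀ {L : ℕ} [NeZero L] {Φ V : Interaction (TorusSite d L × κ) q}, Φ.IsLocal →
      (∀ Z, r₀ < torusDiam Z → Φ Z = 0) → (∀ Z, ‖Φ Z‖ ≤ 1) → V.IsLocal →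
      (∀ Z, r < torusDiam Z → V Z = 0) → (∀ Z, ‖V Z‖ ≤ 1) → ∀ {c : ℝ}, |c| ≤ 1 →
      ∀ (x : TorusSite d L) {O : Op (TorusSite d L × κ) q}, IsSupportedOn O (cellBall x R) →
      ∀ ℓ : ℕ,
      ‖(∫ t : ℝ, w t • heisenbergEvolution (∑ Z, Φ Z + (c : ℂ) • ∑ Z, V Z) t O) -
          twirl (cellBall x (R + ℓ))ᶜ
            (∫ t : ℝ, w t • heisenbergEvolution (∑ Z, Φ Z + (c : ℂ) • ∑ Z, V Z) t O)‖ ≤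
        ‖O‖ * (C / ((ℓ : ℝ) + 1) ^ p) := by
  set Rb : ℕ := max r₀ r with hRb
  set J : ℝ := (2 : ℝ) ^ ((2 * r₀ + 1) ^ d * Fintype.card κ) +
    (2 : ℝ) ^ ((2 * r + 1) ^ d * Fintype.card κ) with hJ
  have hJ0 : 0 ≤ J := by positivity
  set Vc : ℕ := (2 * Rb + 1) ^ d * Fintype.card κ + 1 with hVc
  have hVc1 : 1 ≤ Vc := Nat.le_add_left 1 _
  set N : ℕ := (2 * R + 1) ^ d * Fintype.card κ with hN
  set Nw : ℝ := ∫ t : ℝ, ‖w t‖ with hNw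
  have hNw0 : 0 ≤ Nw := integral_nonneg fun t => norm_nonneg _
  obtain ⟨B, hB0, hB⟩ :=
    exists_norm_smoothing_sub_twirl_le_div_pow_uniform d (κ := κ) q hw hmomi hJ0 hVc1 N Rb R p
  refine ⟨B * (2 * ((Rb : ℝ) + 1)) ^ p + 2 * Nw * ((Rb : ℝ) + 1) ^ p, by positivity, ?_⟩
  intro L _ Φ V hΦ hΦr hΦn hV hVr hVn c hc x O hO ℓ
  obtain ⟨hΘ, hΘr, hΘJ, hΘV, hΘH⟩ := combo_interaction hΦ hΦr hΦn hV hVr hVn hc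
  have hH : (∑ Z, Φ Z + (c : ℂ) • ∑ Z, V Z).IsHermitian := by
    rw [← hΘH]; exact localHamiltonian_isHermitian hΘ univ
  set F : Op (TorusSite d L × κ) q :=
    ∫ t : ℝ, w t • heisenbergEvolution (∑ Z, Φ Z + (c : ℂ) • ∑ Z, V Z) t O with hF
  set e : ℝ := ‖F - twirl (cellBall x (R + ℓ))ᶜ F‖ with he
  -- the trivial bound
  have hFn : ‖F‖ ≤ Nw * ‖O‖ := norm_integral_smul_heisenbergEvolution_le hH w O
  have hM : e ≤ 2 * Nw * ‖O‖ := by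
    calc e ≤ ‖F‖ + ‖twirl (cellBall x (R + ℓ))ᶜ F‖ := norm_sub_le _ _
      _ ≤ ‖F‖ + ‖F‖ := add_le_add le_rfl (norm_twirl_le _ F)
      _ ≤ 2 * Nw * ‖O‖ := by linarith
  -- the coarse-grained bound
  have hC : Rb + 1 ≤ ℓ + 1 → e ≤ ‖O‖ * B / ((((ℓ + 1) / (Rb + 1) : ℕ) : ℝ)) ^ p := by
    intro hℓ
    have hℓ' : Rb ≤ ℓ := by omega
    have h := hB hΘ hΘr hΘJ (fun Z hZ => (hΘV Z hZ).trans (Nat.le_succ _)) x (card_cellBall_le x R)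
      hO hℓ'
    rwa [hΘH] at h
  have key := le_pow_bound_of_floor_bound (Nat.succ_pos Rb) (norm_nonneg _) hM
    (mul_nonneg (norm_nonneg O) hB0) hC
  refine key.trans (le_of_eq ?_)
  push_cast
  ring

end Main

end Literature.MathematicalPhysics.QuantumLattice
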